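import Summits.ResolutionOfSingularities.ResolutionOfSingularities.Theorems.FrobeniusLadderFInjectiveMacaulayficationBlowupFiModelOfCover
import Literature.AlgebraicGeometry.Resolution.AffineBlowupIntegral
import HarnessLib

/-!
# THE ABSTRACT STRONG⁺ WRAPPER: a blow-up `Bl_I (Spec R)` whose stalks all satisfy the crux clause is a confined iso-step
# at the generic point `η` of `V(I)` (crux `FInjectiveMacaulayfication` stmt-ResolutionOfSingularities-15315, chain w45a, hole #3;
# res-L1-w45a-plan-1 RULING R8.3 2026-08-27T05:07:54Z «state the wrapper's main theorem over an ABSTRACT model input … so that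
# (H3-rel) and lead-1's (H3-gd-rel) plug into the SAME wrapper with no second scheme-level file»)

Support file for crux stmt-ResolutionOfSingularities-15315 (`FrobeniusLadder.FInjectiveMacaulayfication`), chain w45a, seat
res-D-pv-017 AS res-L1-w45a-stub-5. [OURS · L1 W4.5a] — NOT a statement of any manuscript; AI-written, weaker than expert review.

INPUT (ring level, engine-agnostic): a Noetherian domain `R`, a non-zero ideal `I`, a point `η` of `Spec R` whose prime has the same
prime over-ideals as `I` (`∀ P prime, I ≤ P ↔ η.asIdeal ≤ P`, i.e. `V(I) = closure {η}`), and the crux clause (domain ∧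
Cohen–Macaulay ∧ Frobenius-closed parameter ideals) at EVERY stalk of `affineBlowup I`. OUTPUT: the ∃-clause of the registered
hole-#3 stub `stub_confinedIsoStepStrongPlus` VERBATIM for `X₁ = Spec R` and this `η` — `X₂ = affineBlowup I`, proper, birational
(`affineBlowup.isBirational`), integral (`affineBlowup.isIntegral`, Stacks 02ND), everywhere CM, an isomorphism exactly off
`closure {η}` (Stacks 02OS: `affineBlowup.isIso_morphismRestrict_iSup`, the open `⋃_(a ∈ I) D(a)` being the complement of
`closure {η} = V(I)`), and the full clause at the (non-closed) points over `closure {η}` — empty residual.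

Consumers: the CN instance `CNStrongPlusStepRel.strongPlusStep_of_cnData` (p499436; `I = I_A R`, `η` = the prime `(x̄ⱼ : j ∈ J)`,
`hsupp` = `CNStrongPlusStepRel.centre_le_iff`, `hcl` = `CNConeFiModelRelBlowup.affineBlowup_fiClause_of_cnData`) and lead-1's
relative GRADED engine (H3-gd-rel, `I = I_N` on the linear stratum). No definitions, no named facts. [cite: StacksProject, Tags 02OS, 02ND]
-/

-- single-problem summit: the doubled namespace component is forced
set_option linter.dupNamespace false

noncomputable section

open AlgebraicGeometry CategoryTheory Literature.AlgebraicGeometry.Resolution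

namespace Summit.ResolutionOfSingularities.ResolutionOfSingularities.Theorems.FInjectiveMacaulayfication.StrongPlusStepOfAffineBlowup

open Summit.ResolutionOfSingularities.ResolutionOfSingularities.Theorems.FInjectiveMacaulayfication

/-- **THE ABSTRACT STRONG⁺ WRAPPER** (module docstring): `R` a Noetherian domain, `I ≠ 0`, `η ∈ Spec R` with `V(I) = closure {η}`
(as the equivalence `I ≤ P ↔ η.asIdeal ≤ P` on primes), and the crux clause at every stalk of `affineBlowup I` ⇒ the ∃-clause of
`stub_confinedIsoStepStrongPlus` for `X₁ = Spec R` at `η`, witnessed by `X₂ = affineBlowup I`. The prime `p` enters only through the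
Frobenius-closure clause. [cite: StacksProject, Tags 02OS, 02ND] -/
theorem strongPlusStep_of_affineBlowup (p : ℕ) (R : Type) [CommRing R] [IsDomain R] [IsNoetherianRing R]
    (I : Ideal R) (hI0 : I ≠ ⊥) (η : ↥(Spec (.of R)))
    (hsupp : ∀ (P : Ideal R) [P.IsPrime], I ≤ P ↔ η.asIdeal ≤ P)
    (hcl : ∀ y : ↥(affineBlowup I), IsDomain ((affineBlowup I).presheaf.stalk y) ∧
      ∀ d : ℕ, ringKrullDim ((affineBlowup I).presheaf.stalk y) = d →
        ∀ s : Fin d → (affineBlowup I).presheaf.stalk y, (Ideal.span (Set.range s)).radical.IsMaximal →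
          RingTheory.Sequence.IsWeaklyRegular ((affineBlowup I).presheaf.stalk y) (List.ofFn s) ∧
          ∀ z : (affineBlowup I).presheaf.stalk y, (∃ e : ℕ, z ^ p ^ e ∈
              Ideal.span ((fun w : (affineBlowup I).presheaf.stalk y => w ^ p ^ e) ''
                (Ideal.span (Set.range s) : Set ((affineBlowup I).presheaf.stalk y)))) →
            z ∈ Ideal.span (Set.range s)) :
    ∃ (X₂ : Scheme.{0}) (π : X₂ ⟶ Spec (.of R)), IsProper π ∧
      Literature.AlgebraicGeometry.Resolution.IsBirational π ∧
      IsIntegral X₂ ∧ (∀ x : X₂, (∀ d : ℕ, ringKrullDim (X₂.presheaf.stalk x) = d → ∀ s : Fin d → X₂.presheaf.stalk x, (Ideal.span (Set.range s)).radical.IsMaximal → RingTheory.Sequence.IsWeaklyRegular (X₂.presheaf.stalk x) (List.ofFn s))) ∧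
      IsIso (π ∣_ ⟨(closure ({η} : Set ↥(Spec (.of R))))ᶜ, isClosed_closure.isOpen_compl⟩) ∧
      ∀ x : X₂, π.base x ∈ closure ({η} : Set ↥(Spec (.of R))) → ¬ IsClosed ({x} : Set X₂) → (IsDomain (X₂.presheaf.stalk x) ∧ ∀ d : ℕ, ringKrullDim (X₂.presheaf.stalk x) = d → ∀ s : Fin d → X₂.presheaf.stalk x, (Ideal.span (Set.range s)).radical.IsMaximal → RingTheory.Sequence.IsWeaklyRegular (X₂.presheaf.stalk x) (List.ofFn s) ∧ ∀ t : X₂.presheaf.stalk x, (∃ e : ℕ, t ^ p ^ e ∈ Ideal.span ((fun z : X₂.presheaf.stalk x => z ^ p ^ e) '' (Ideal.span (Set.range s) : Set (X₂.presheaf.stalk x)))) → t ∈ Ideal.span (Set.range s)) := by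
  -- `closure {η} = V(η) = V(I)`: membership in the closure is `I ≤ x.asIdeal`
  have key : ∀ x : ↥(Spec (.of R)), x ∈ closure ({η} : Set ↥(Spec (.of R))) ↔ I ≤ x.asIdeal := by
    intro x
    refine specializes_iff_mem_closure.symm.trans ?_
    refine (PrimeSpectrum.le_iff_specializes η x).symm.trans ?_
    change η.asIdeal ≤ x.asIdeal ↔ I ≤ x.asIdeal
    exact (hsupp x.asIdeal).symm
  -- hence the complement of `closure {η}` is the open `⋃_(a ∈ I) D(a)` over which the blow-up is an isomorphism (Stacks 02OS)
  have hU : (⟨(closure ({η} : Set ↥(Spec (.of R))))ᶜ, isClosed_closure.isOpen_compl⟩ : (Spec (.of R)).Opens) =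
      ⨆ a : I, (PrimeSpectrum.basicOpen (a : R) : (Spec (.of R)).Opens) := by
    apply TopologicalSpace.Opens.ext
    ext x
    constructor
    · intro hx
      have hx' : ¬ I ≤ x.asIdeal := fun hle => hx ((key x).mpr hle)
      by_contra hcon
      apply hx'
      intro r hr
      by_contra hrx
      exact hcon (TopologicalSpace.Opens.mem_iSup.mpr ⟨⟨r, hr⟩, (PrimeSpectrum.mem_basicOpen _ _).mpr hrx⟩)
    · intro hx
      show x ∉ closure ({η} : Set ↥(Spec (.of R)))
      intro hxc
      obtain ⟨r, hr⟩ := TopologicalSpace.Opens.mem_iSup.mp hx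
      exact (PrimeSpectrum.mem_basicOpen _ _).mp hr (((key x).mp hxc) r.2)
  have hiso : IsIso (affineBlowup.π I ∣_ ⟨(closure ({η} : Set ↥(Spec (.of R))))ᶜ, isClosed_closure.isOpen_compl⟩) := by
    rw [hU]
    exact affineBlowup.isIso_morphismRestrict_iSup
  exact ⟨affineBlowup I, affineBlowup.π I, inferInstance, affineBlowup.isBirational hI0, affineBlowup.isIntegral hI0,
    fun x d hd s hs => ((hcl x).2 d hd s hs).1, hiso, fun x _ _ => ⟨(hcl x).1, fun d hd s hs => (hcl x).2 d hd s hs⟩⟩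

/-- **The radical form of the support hypothesis**: if `I.radical = η.asIdeal` then `I ≤ P ↔ η.asIdeal ≤ P` for every prime `P`
(so `strongPlusStep_of_affineBlowup` applies with `hsupp := supp_iff_of_radical_eq …`). [folklore] -/
theorem supp_iff_of_radical_eq {R : Type} [CommRing R] (I : Ideal R) (η : ↥(Spec (.of R))) (hrad : I.radical = η.asIdeal)
    (P : Ideal R) [P.IsPrime] : I ≤ P ↔ η.asIdeal ≤ P := by
  rw [← hrad]
  exact ⟨fun h => (Ideal.IsPrime.radical_le_iff inferInstance).mpr h, fun h => Ideal.le_radical.trans h⟩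

end Summit.ResolutionOfSingularities.ResolutionOfSingularities.Theorems.FInjectiveMacaulayfication.StrongPlusStepOfAffineBlowup

end
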